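/-
COR-CM (cell pub-hodgecm2) — RSCONJ («`RecordSystem.conj`», IDENT-LEMMA component (e) «SPACE by construction»; coordinator 04:22Z,
PLANNER-A RSCONJ TABLE HOME∕INBOX l.14934), row F2b = the `hol` clause of the conjugate (complex) record system.  Pen
prover-pub-hodgecm2-rsconj-p2-g0-0.  KERNEL: theorems only; no definition, no instance, no named fact, no notation, no `sorry`.
HC_CM is NOT proved; HELD — WORLD = C FINAL; this file discharges no END binder and claims nothing about (iv-c).
-/
import Summits.HodgeConjecture.CorCM.B01.Transposition.HComp.RecordSystemConjFrame
import Literature.AlgebraicGeometry.ShimuraVarieties.UnitaryBallConjugateDatum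
import HarnessLib

/-!
# RSCONJ row F2b: the `hol` clause of the conjugate record system

For a Deligne record system `R` of the compact unitary Shimura surface `Sh(U(H), 𝔹²)` below `K₀` (frame `T` at `τ`;
`UnitaryCanonicalModel.RecordSystem`), the RSCONJ chain shows that the twisted system `K' ↦ M_{c⁻¹K'} ⊗_{L,c} L` is a record system of
the CONJUGATE hermitian space `c(H)` along the same `τ` with the conjugate frame `T̄` (FRAME file `RecordSystemConjFrame`).  Its
complex side is the conjugate complex record system `K' ↦ (Mc_{c⁻¹K'})^{conj}` (`conjMc`), and this file supplies the clause (C2b)∕(F2b)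
`hol`: «`z ↦ [z, aK']` is holomorphic in every algebraic coordinate of the conjugate variety».

* §0 calculus: `hasFDerivWithinAt_comp_semilinear` (`L ∘ f ∘ R` WITHIN `R ⁻¹' s` for semilinear `L`, `R` — the within-a-set version of
  Mathlib's `HasFDerivAt.comp_semilinear`) and `differentiableWithinAt_star_star` (`conj ∘ g ∘ star` is holomorphic within `star ⁻¹' s`
  at `v` when `g` is within `s` at `v̄`).  Needed because a record's `hol` witness `u` is only `DifferentiableOn` on `negCone ∩ u⁻¹'U`, a set
  not known to be open.
* §1 generic over `ℂ`: `mem_negCone_map_conj_iff` and `hol_toConjugate` — if `u : ℂᵐ → X(ℂ)` is `ℂˣ`-invariant and holomorphic in every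
  algebraic coordinate of `X` on `negCone Hc`, then `v ↦ toConjugate (u v̄)` is so on `negCone (conj Hc)` in the algebraic coordinates of
  `X^{conj}` — the argument of the tree's `UnitaryBallUniformisationDatum.conjugate` (section dictionary `evalOrZero_toConjugate` +
  `star_star`) for an arbitrary `u`.
* §2 `star_conjFrame_mulVec_lift` (`star (T̄ ·ᵥ (x,1)) = T ·ᵥ (x̄,1)`), `conjGram_map` (`(cH)^τ = conj (H^τ)`).
* §3 `ComplexRecord.hol_conj` ∕ `ComplexRecordSystem.hol_conj` ∕ `RecordSystem.hol_conj`: the `hol` clause for the conjugate datum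
  `(c(H), τ, T̄)` on the conjugate variety, clause 1 read at the conjugate point `toConjugate (pts⁻¹ [x̄, bK])` (the assembly rewrites it with
  the point formula `conjPts⁻¹ [x, aK'] = toConjugate (pts⁻¹ [x̄, (c⊗1)⁻¹ a])`).

References: [SerreGAGA1956] §2 (the conjugate complex structure); [Deligne1979ShimuraVarieties] 2.1.2, 2.2.5 (Milne's translation,
PDF pp. 24, 29); [BergeronMillsonMoeglin2016Balls] Part 2 §1.3 (the negative cone).
-/

set_option autoImplicit false

noncomputable section

open CategoryTheory AlgebraicGeometry NumberField Matrix Topology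
open scoped ComplexConjugate
open Literature.AlgebraicGeometry.Motives Literature.AlgebraicGeometry.Motives.AlgPoints
open Literature.AlgebraicGeometry.ShimuraVarieties
open Literature.NumberTheory.Automorphic.Liu2021.AppendixC (C5.OpenCompactSubgroup C5.SmallLevel)

namespace Summit.HodgeConjecture.CorCM.Model.RecordSystemConj

/-! ## §0 Calculus: `L ∘ f ∘ R` WITHIN a set, for semilinear `L`, `R` (the within-version of Mathlib's
`HasFDerivAt.comp_semilinear` ∕ `DifferentiableAt.star_star`) -/

section Semilinear

variable {𝕜 V V' W W' : Type*} [NontriviallyNormedField 𝕜] {σ σ' : RingHom 𝕜 𝕜}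
  [NormedAddCommGroup V] [NormedSpace 𝕜 V] [NormedAddCommGroup V'] [NormedSpace 𝕜 V']
  [NormedAddCommGroup W] [NormedSpace 𝕜 W] [NormedAddCommGroup W'] [NormedSpace 𝕜 W']
  [RingHomIsometric σ] [RingHomInvPair σ σ'] (Lm : W →SL[σ] W') (Rm : V' →SL[σ'] V)

/-- If `L` and `R` are semilinear maps whose composite is linear and `f` has derivative `f'` at `R z` WITHIN `s`, then
`L ∘ f ∘ R` has derivative `L ∘ f' ∘ R` at `z` within `R ⁻¹' s` (the within-a-set version of Mathlib's
`HasFDerivAt.comp_semilinear`, same proof along `𝓝[s]`). [folklore] -/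
theorem hasFDerivWithinAt_comp_semilinear {f : V → W} {s : Set V} {z : V'} {f' : V →L[𝕜] W}
    (hf : HasFDerivWithinAt f f' s (Rm z)) :
    HasFDerivWithinAt (Lm ∘ f ∘ Rm) (Lm.comp (f'.comp Rm)) (Rm ⁻¹' s) z := by
  have : RingHomIsometric σ' := .inv σ
  rw [hasFDerivWithinAt_iff_isLittleO] at hf ⊢
  have hR : Filter.Tendsto Rm (𝓝[Rm ⁻¹' s] z) (𝓝[s] (Rm z)) :=
    Rm.continuous.continuousWithinAt.tendsto_nhdsWithin (Set.mapsTo_preimage Rm s)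
  have h1 := hf.comp_tendsto hR
  have h2 : (fun z' => Rm z' - Rm z) =O[𝓝[Rm ⁻¹' s] z] (fun z' => z' - z) :=
    (Rm.isBigO_sub (𝓝[Rm ⁻¹' s] z) z).congr_left fun z' => by simp only [map_sub]
  have h3 := ((Lm.isBigO_comp _ (𝓝[Rm ⁻¹' s] z)).trans_isLittleO h1).trans_isBigO h2
  refine h3.congr_left fun z' => ?_
  simp only [Function.comp_apply, map_sub, ContinuousLinearMap.comp_apply]

end Semilinear

section StarStar

variable {m : Type*} [Fintype m]

/-- **`conj ∘ g ∘ star` is holomorphic WITHIN `star ⁻¹' s` at `v` when `g` is holomorphic within `s` at `v̄`** (`ℂᵐ → ℂ`;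
the within-a-set version of Mathlib's `DifferentiableAt.star_star`). [folklore] -/
theorem differentiableWithinAt_star_star {g : (m → ℂ) → ℂ} {s : Set (m → ℂ)} {v : m → ℂ}
    (hg : DifferentiableWithinAt ℂ g s (star v)) :
    DifferentiableWithinAt ℂ (star ∘ g ∘ star) (star ⁻¹' s) v := by
  have h := hasFDerivWithinAt_comp_semilinear (starL ℂ : ℂ ≃L⋆[ℂ] ℂ).toContinuousLinearMap
    (starL ℂ : (m → ℂ) ≃L⋆[ℂ] (m → ℂ)).toContinuousLinearMap (f := g) (s := s) (z := v)
    (by simpa using hg.hasFDerivWithinAt)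
  exact h.differentiableWithinAt

end StarStar

/-! ## §1 Generic: holomorphy in algebraic coordinates passes to the conjugate variety -/

section Generic

variable {m : Type*} [Fintype m]

/-- `v ∈ negCone (conj Hc) ↔ v̄ ∈ negCone Hc`, for ANY complex matrix `Hc` (`⟪v,v⟫_{conj Hc} = conj ⟪v̄,v̄⟫_{Hc}`).
[cite: BergeronMillsonMoeglin2016Balls, Part 2 §1.3] -/
theorem mem_negCone_map_conj_iff {Hc : Matrix m m ℂ} {v : m → ℂ} :
    v ∈ negCone (Hc.map (starRingEnd ℂ)) ↔ star v ∈ negCone Hc := by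
  have key : hermForm (starRingEnd ℂ) (Hc.map (starRingEnd ℂ)) v v =
      starRingEnd ℂ (hermForm (starRingEnd ℂ) Hc (star v) (star v)) := by
    have h := map_hermForm (σ := starRingEnd ℂ) (starRingEnd ℂ) (fun _ => rfl) Hc (star v) (star v)
    have hv : (⇑(starRingEnd ℂ) ∘ star v) = v := funext fun i => by simp
    rw [hv] at h
    exact h.symm
  simp only [negCone, Set.mem_setOf_eq, key, Complex.conj_re]

variable {X : SchemeOver ℂ}

/-- **Holomorphy in algebraic coordinates passes to the conjugate variety.**  If `u : ℂᵐ → X(ℂ)` is `ℂˣ`-invariant on the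
negative cone of `Hc` and, for every affine open `U ⊆ X` and every regular `f` on `U`, `v ↦ f(u(v))` is holomorphic on the part of
`negCone Hc` mapped into `U`, then `u' : v ↦ toConjugate (u v̄)` (a map into the complex points of the conjugate variety
`X^{conj} = X ×_{ℂ,conj} ℂ`) is `ℂˣ`-invariant on `negCone (conj Hc) = star ⁻¹' negCone Hc` and, for every affine open `U'` of
`X^{conj}` and regular `f'` on `U'`, `v ↦ f'(u'(v))` is holomorphic on the part of `negCone (conj Hc)` mapped into `U'`:
`f' ∘ u' = conj ∘ (((inv π)^* f') ∘ u) ∘ star` by the section dictionary of the conjugate variety (`evalOrZero_toConjugate`), and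
`conj ∘ g ∘ star` is holomorphic where `g` is (Mathlib `DifferentiableAt.star_star`).  This is the argument of the tree's
`UnitaryBallUniformisationDatum.conjugate` for an arbitrary `u`. [cite: SerreGAGA1956, §2] -/
theorem hol_toConjugate (Hc : Matrix m m ℂ) (u : (m → ℂ) → ComplexPoints X)
    (h2 : ∀ v ∈ negCone Hc, ∀ c : ℂ, c ≠ 0 → u (c • v) = u v)
    (h3 : ∀ (U : X.left.affineOpens) (f : X.left.presheaf.obj (Opposite.op (↑U : X.left.Opens))),
      DifferentiableOn ℂ (fun v ↦ evalOrZero (↑U : X.left.Opens) f (u v)) (negCone Hc ∩ u ⁻¹' {P | P.pt ∈ (↑U : X.left.Opens)})) :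
    (∀ v ∈ negCone (Hc.map (starRingEnd ℂ)), ∀ c : ℂ, c ≠ 0 →
        toConjugate conjAut X (u (star (c • v))) = toConjugate conjAut X (u (star v))) ∧
      ∀ (U' : (conjugateVariety conjAut X).left.affineOpens)
        (f' : (conjugateVariety conjAut X).left.presheaf.obj (Opposite.op (↑U' : (conjugateVariety conjAut X).left.Opens))),
        DifferentiableOn ℂ (fun v ↦ evalOrZero (↑U' : (conjugateVariety conjAut X).left.Opens) f' (toConjugate conjAut X (u (star v))))
          (negCone (Hc.map (starRingEnd ℂ)) ∩
            (fun v ↦ toConjugate conjAut X (u (star v))) ⁻¹' {P | P.pt ∈ (↑U' : (conjugateVariety conjAut X).left.Opens)}) := by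
  refine ⟨fun v hv c hc => ?_, fun U' f' => ?_⟩
  · rw [star_smul, h2 (star v) (mem_negCone_map_conj_iff.1 hv) (star c) (star_ne_zero.2 hc)]
  · -- the corresponding affine open of `X` and the pushed-forward section
    have hU : IsAffineOpen (invPreimage conjAut X (U' : (conjugateVariety conjAut X).left.Opens)) :=
      isAffineOpen_invPreimage U'.2
    have hg := h3 ⟨_, hU⟩ ((inv (conjFst conjAut X)).app (U' : (conjugateVariety conjAut X).left.Opens) f')
    -- the function is `conj ∘ g ∘ star`
    have hfun : (fun v ↦ evalOrZero (↑U' : (conjugateVariety conjAut X).left.Opens) f' (toConjugate conjAut X (u (star v)))) =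
        star ∘ (fun w ↦ evalOrZero (invPreimage conjAut X (U' : (conjugateVariety conjAut X).left.Opens))
          ((inv (conjFst conjAut X)).app (U' : (conjugateVariety conjAut X).left.Opens) f') (u w)) ∘ star := by
      funext v
      simp only [Function.comp_apply, evalOrZero_toConjugate]
      rfl
    -- the set is `star ⁻¹'` of the corresponding set for `u`
    have hset : negCone (Hc.map (starRingEnd ℂ)) ∩
          (fun v ↦ toConjugate conjAut X (u (star v))) ⁻¹' {P | P.pt ∈ (↑U' : (conjugateVariety conjAut X).left.Opens)} =
        star ⁻¹' (negCone Hc ∩ u ⁻¹'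
          {P | P.pt ∈ invPreimage conjAut X (U' : (conjugateVariety conjAut X).left.Opens)}) := by
      ext v
      simp only [Set.mem_inter_iff, Set.mem_preimage, Set.mem_setOf_eq, pt_toConjugate_mem_iff', mem_negCone_map_conj_iff]
    rw [hfun, hset]
    intro v hv
    exact differentiableWithinAt_star_star (hg (star v) hv)

end Generic

/-! ## §2 Frame ∕ Gram ∕ ball bookkeeping on top of the FRAME (`conjFrame`, `conjGram`, `conjBall`, `lift_conjBall`,
`conjFrame_mulVec_star` are the FRAME's, mukey-p6 ∕ mukey-p2) -/

section Frame

open Literature.Geometry.ComplexHyperbolic Literature.Geometry.ComplexHyperbolic.BallModel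

variable (L : Type) [Field L] [NumberField L] [IsCMField L]

/-- `star (T̄ ·ᵥ lift x) = T ·ᵥ lift x̄` (this file). [folklore] -/
theorem star_conjFrame_mulVec_lift (T : GL (Fin 3) ℂ) (x : Ball) :
    star (((conjFrame T : GL (Fin 3) ℂ) : Matrix (Fin 3) (Fin 3) ℂ) *ᵥ BallModel.lift x) =
      (T : Matrix (Fin 3) (Fin 3) ℂ) *ᵥ BallModel.lift (conjBall x) := by
  have h := conjFrame_mulVec_star T (star (BallModel.lift x))
  rw [star_star] at h
  rw [h, star_star, lift_conjBall]

/-- `(cH)^τ = conj (H^τ)` entrywise (CM: `τ ∘ c = conj ∘ τ`; this file). [folklore] -/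
theorem conjGram_map (H : Matrix (Fin 3) (Fin 3) L) (τ : L →+* ℂ) :
    (conjGram L H).map τ = (H.map τ).map (starRingEnd ℂ) := by
  ext i j
  simp only [Matrix.map_apply, RingHom.coe_coe, NumberField.IsCMField.complexEmbedding_complexConj]

end Frame

/-! ## §3 The `hol` clause for the conjugate datum `(c(H), τ, T̄)` on the conjugate variety -/

section Hol

open Literature.AlgebraicGeometry.ShimuraVarieties.UnitaryCanonicalModel
open Literature.NumberTheory.Automorphic Literature.NumberTheory.Automorphic.UnitaryGroup
open Literature.NumberTheory.Automorphic.Liu2021.AppendixC (C5.OpenCompactSubgroup C5.SmallLevel)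
open Literature.Geometry.ComplexHyperbolic Literature.Geometry.ComplexHyperbolic.BallModel

variable {L : Type} [Field L] [NumberField L] [IsCMField L] {H : Matrix (Fin 3) (Fin 3) L}
  {τ : L →+* ℂ} {T : GL (Fin 3) ℂ} {hT : formCongr (starRingEnd ℂ) T (H.map τ) = BallModel.J}

/-- **F2b at one level, complex-record form.**  For a complex record `C` of `Sh_K(U(H), 𝔹²)` and `b ∈ U(H)(𝔸_{L⁺,f})`, the map
`v ↦ toConjugate (u v̄)` — `u` the `hol` witness of `C` at `b` — is a `hol` witness for the CONJUGATE datum `(c(H), τ, T̄)` on the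
conjugate variety `C.Mc^{conj}`: (1) at `T̄ ·ᵥ (x,1)` it is the conjugate point `toConjugate ((C.pts)⁻¹ [x̄, bK])`; (2) it is
`ℂˣ`-invariant on `negCone ((cH)^τ) = star ⁻¹' negCone (H^τ)`; (3) it is holomorphic in every algebraic coordinate of `C.Mc^{conj}`
there (§1).  The consumer reads (1) through the point formula `(pts')⁻¹ [x, aK'] = toConjugate ((C.pts)⁻¹ [x̄, (c⊗1)⁻¹a K])`,
`K = c⁻¹K'`. [cite: SerreGAGA1956, §2] [cite: Deligne1979ShimuraVarieties, 2.1.2 (PDF p. 24 of Milne's translation)] -/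
theorem ComplexRecord.hol_conj {K : Subgroup (finAdelic (↥(maximalRealSubfield L)) L (IsCMField.complexConj L) 3 H)}
    (C : ComplexRecord L H τ T hT K) (b : finAdelic (↥(maximalRealSubfield L)) L (IsCMField.complexConj L) 3 H) :
    ∃ u : (Fin 3 → ℂ) → ComplexPoints (conjugateVariety conjAut C.Mc),
      (∀ x : Ball, u (((conjFrame T : GL (Fin 3) ℂ) : Matrix (Fin 3) (Fin 3) ℂ) *ᵥ BallModel.lift x) =
          toConjugate conjAut C.Mc (C.pts.symm (ShimuraSet.mk L H τ T hT K (conjBall x) b))) ∧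
      (∀ v ∈ negCone ((conjGram L H).map τ), ∀ c : ℂ, c ≠ 0 → u (c • v) = u v) ∧
      ∀ (U : (conjugateVariety conjAut C.Mc).left.affineOpens)
        (f : (conjugateVariety conjAut C.Mc).left.presheaf.obj (Opposite.op (↑U : (conjugateVariety conjAut C.Mc).left.Opens))),
        DifferentiableOn ℂ (fun v ↦ evalOrZero (↑U : (conjugateVariety conjAut C.Mc).left.Opens) f (u v))
          (negCone ((conjGram L H).map τ) ∩ u ⁻¹' {P | P.pt ∈ (↑U : (conjugateVariety conjAut C.Mc).left.Opens)}) := by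
  obtain ⟨u, hu1, hu2, hu3⟩ := C.hol b
  obtain ⟨h2, h3⟩ := hol_toConjugate (H.map τ) u hu2 hu3
  refine ⟨fun v => toConjugate conjAut C.Mc (u (star v)), fun x => ?_, ?_, ?_⟩
  · change toConjugate conjAut C.Mc (u (star _)) = _
    rw [star_conjFrame_mulVec_lift, hu1 (conjBall x)]
  · rw [conjGram_map]
    intro v hv c hc
    exact h2 v hv c hc
  · rw [conjGram_map]
    exact h3

variable {K₀ : C5.OpenCompactSubgroup ↥(finAdelic (↥(maximalRealSubfield L)) L (IsCMField.complexConj L) 3 H)}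

/-- **F2b, complex-record-SYSTEM form**: the same at every small level `K ≤ K₀` of a complex record system `Sc`, on the conjugate
variety `(Sc.Mc K)^{conj}`. [cite: SerreGAGA1956, §2] [cite: Deligne1979ShimuraVarieties, 2.1.2–2.1.4 (PDF p. 24 of Milne's translation)] -/
theorem ComplexRecordSystem.hol_conj (Sc : ComplexRecordSystem L H τ T hT K₀) (K : C5.SmallLevel K₀)
    (b : finAdelic (↥(maximalRealSubfield L)) L (IsCMField.complexConj L) 3 H) :
    ∃ u : (Fin 3 → ℂ) → ComplexPoints (conjugateVariety conjAut (Sc.Mc.obj K)),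
      (∀ x : Ball, u (((conjFrame T : GL (Fin 3) ℂ) : Matrix (Fin 3) (Fin 3) ℂ) *ᵥ BallModel.lift x) =
          toConjugate conjAut (Sc.Mc.obj K) ((Sc.pts K).symm (ShimuraSet.mk L H τ T hT K.1.1 (conjBall x) b))) ∧
      (∀ v ∈ negCone ((conjGram L H).map τ), ∀ c : ℂ, c ≠ 0 → u (c • v) = u v) ∧
      ∀ (U : (conjugateVariety conjAut (Sc.Mc.obj K)).left.affineOpens)
        (f : (conjugateVariety conjAut (Sc.Mc.obj K)).left.presheaf.obj
          (Opposite.op (↑U : (conjugateVariety conjAut (Sc.Mc.obj K)).left.Opens))),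
        DifferentiableOn ℂ (fun v ↦ evalOrZero (↑U : (conjugateVariety conjAut (Sc.Mc.obj K)).left.Opens) f (u v))
          (negCone ((conjGram L H).map τ) ∩ u ⁻¹' {P | P.pt ∈ (↑U : (conjugateVariety conjAut (Sc.Mc.obj K)).left.Opens)}) :=
  ComplexRecord.hol_conj (Sc.record K) b

/-- **F2b, record-SYSTEM form (the shape row A ∕ `RecordSystem.exists_conj` consumes).**  For Deligne's record system `R` of
`Sh(U(H), 𝔹²)` below `K₀`, a small level `K ≤ K₀` and `b ∈ U(H)(𝔸_{L⁺,f})`: a `hol` witness for the conjugate datum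
`(c(H), τ, T̄)` on the conjugate complex surface `((M_K)_τ)^{conj}` (`(M_K)_τ = M_K ⊗_{L,τ} ℂ`), whose value at `T̄ ·ᵥ (x,1)` is
the conjugate of the point `(M_K)_τ(ℂ) ∋ baseChangeEquiv τ M_K ((R.pts K)⁻¹ [x̄, bK])`.  Along the `ℂ`-isomorphism
`(M_K ⊗_{L,c} L)_τ ≅ ((M_K)_τ)^{conj}` (base-change transitivity through `M_K ⊗_{conj ∘ τ = τ ∘ c} ℂ`) and the point formula (P)
this is VERBATIM the `hol` clause of the conjugate system `K' ↦ M_{c⁻¹K'} ⊗_{L,c} L` at `(K', a)`, `b = (c ⊗ 1)⁻¹ a` — transported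
exactly as `RecordSystem.nonempty_of_descent` transports `Sc.hol` along `e` (`AlgPoints.evalOrZero_map`,
`IsAffineOpen.preimage_of_isIso`). [cite: SerreGAGA1956, §2] [cite: Deligne1979ShimuraVarieties, 2.2.5 (PDF p. 29 of Milne's translation)] -/
theorem RecordSystem.hol_conj (R : RecordSystem L H τ T hT K₀) (K : C5.SmallLevel K₀)
    (b : finAdelic (↥(maximalRealSubfield L)) L (IsCMField.complexConj L) 3 H) :
    letI : Algebra L ℂ := τ.toAlgebra
    ∃ u : (Fin 3 → ℂ) → ComplexPoints (conjugateVariety conjAut ((baseChangeHom τ).obj (R.M.obj K))),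
      (∀ x : Ball, u (((conjFrame T : GL (Fin 3) ℂ) : Matrix (Fin 3) (Fin 3) ℂ) *ᵥ BallModel.lift x) =
          toConjugate conjAut ((baseChangeHom τ).obj (R.M.obj K))
            (AlgPoints.baseChangeEquiv τ (R.M.obj K) ((R.pts K).symm (ShimuraSet.mk L H τ T hT K.1.1 (conjBall x) b)))) ∧
      (∀ v ∈ negCone ((conjGram L H).map τ), ∀ c : ℂ, c ≠ 0 → u (c • v) = u v) ∧
      ∀ (U : (conjugateVariety conjAut ((baseChangeHom τ).obj (R.M.obj K))).left.affineOpens)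
        (f : (conjugateVariety conjAut ((baseChangeHom τ).obj (R.M.obj K))).left.presheaf.obj
          (Opposite.op (↑U : (conjugateVariety conjAut ((baseChangeHom τ).obj (R.M.obj K))).left.Opens))),
        DifferentiableOn ℂ
          (fun v ↦ evalOrZero (↑U : (conjugateVariety conjAut ((baseChangeHom τ).obj (R.M.obj K))).left.Opens) f (u v))
          (negCone ((conjGram L H).map τ) ∩
            u ⁻¹' {P | P.pt ∈ (↑U : (conjugateVariety conjAut ((baseChangeHom τ).obj (R.M.obj K))).left.Opens)}) := by
  letI : Algebra L ℂ := τ.toAlgebra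
  obtain ⟨u, hu1, hu2, hu3⟩ := R.hol K b
  obtain ⟨h2, h3⟩ := hol_toConjugate (H.map τ) u hu2 hu3
  refine ⟨fun v => toConjugate conjAut _ (u (star v)), fun x => ?_, ?_, ?_⟩
  · change toConjugate conjAut _ (u (star _)) = _
    rw [star_conjFrame_mulVec_lift, hu1 (conjBall x)]
  · rw [conjGram_map]
    intro v hv c hc
    exact h2 v hv c hc
  · rw [conjGram_map]
    exact h3

end Hol

end Summit.HodgeConjecture.CorCM.Model.RecordSystemConj

end
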